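import Literature.Analysis.FluidPDE.SawtoothCascadeResponseSourceBounds

/-!
# The profile slot caps of the sawtooth cascade in the bookkeeping form of the line `lip-agmon`
(route `AnomalousDissipation/SawtoothPulseCascade`, crux ApproxSol58 = stmt-AnomalousDissipation-19688;
lead g4, module B/caps)

The hypotheses `hcapH`, `hcapV` of `LipAgmon.lipEnvelope_two_of_caps` read off the tree: on every `H`
(resp. `V`) half-slot of phase `j`, with `s = N_j/δ_j` and the nonnegative pulse rate `rateH j t`
(resp. `rateV j t`), `|∂ᵢ∂ₘΩ̄| ≤ rate · 8π² s²`, `|∂ᵢ∂ₗ∂ₘΩ̄| ≤ rate · (80π³/√(2π)) s³`, and for the curl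
`c = ∂₀g₁ − ∂₁g₀` of the heat-lag force `g = νΔū`: `‖c‖₂ ≤ rate·|ν|·8π² s²`, `‖∇c‖₂ ≤ rate·|ν|·(80π³/√(2π)) s³`,
`(∑‖∂ᵢ∂ₘc‖₂²)^{1/2} ≤ rate·|ν|·192π⁴ s⁴` — from `CascadeParams.abs_partialDeriv2/3_vorticity_field_le_of_mem_H/V`,
`vorticity_viscousForce_eq_coordFun_of_mem_H/V`, `vorticity_viscousForce_sizes_of_mem_H/V` (ad-lit g13) and
`abs_deriv3_U_le`.
-/

set_option linter.dupNamespace false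

noncomputable section

namespace Summit.AnomalousDissipation.AnomalousDissipation.Theorems.SawtoothPulseCascade.LipAgmon

open Set MeasureTheory
open Literature.Analysis Literature.Analysis.FunctionSpaces Literature.Analysis.FluidPDE
open Literature.Analysis.FluidPDE.Torus Literature.Analysis.FunctionSpaces.Torus
open Literature.Analysis.FluidPDE.SawtoothCascade

/-- `√(∫ g²) ≤ B` on `𝕋²` (a probability space) when `|g| ≤ B` pointwise, `B ≥ 0`, `g` continuous. [folklore] -/
theorem sqrt_integral_sq_le_of_abs_le_fin_two {g : UnitAddTorus (Fin 2) → ℝ} (hg : Continuous g) {B : ℝ}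
    (hB0 : 0 ≤ B) (hB : ∀ x, |g x| ≤ B) : Real.sqrt (∫ x, g x ^ 2) ≤ B := by
  rw [Real.sqrt_le_left hB0]
  calc ∫ x, g x ^ 2 ≤ ∫ _ : UnitAddTorus (Fin 2), B ^ 2 :=
        integral_mono (hg.pow 2).integrable_unitAddTorus (integrable_const _) fun x => by
          show g x ^ 2 ≤ B ^ 2
          calc g x ^ 2 = |g x| ^ 2 := (sq_abs _).symm
            _ ≤ B ^ 2 := pow_le_pow_left₀ (abs_nonneg _) (hB x) 2
    _ = B ^ 2 := by simp

/-- The three cap constants as multiples of powers of `s = N_j/δ_j`. [folklore] -/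
theorem cap_consts (P : CascadeParams) (j : ℕ) :
    2 * (2 * Real.pi * (P.N j : ℝ)) ^ 2 / P.δ j ^ 2 = 8 * Real.pi ^ 2 * ((P.N j : ℝ) / P.δ j) ^ 2 ∧
    10 * (2 * Real.pi * (P.N j : ℝ)) ^ 3 / (P.δ j ^ 3 * Real.sqrt (2 * Real.pi)) =
      80 * Real.pi ^ 3 / Real.sqrt (2 * Real.pi) * ((P.N j : ℝ) / P.δ j) ^ 3 ∧
    12 * (2 * Real.pi * (P.N j : ℝ)) ^ 4 / P.δ j ^ 4 = 192 * Real.pi ^ 4 * ((P.N j : ℝ) / P.δ j) ^ 4 := by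
  refine ⟨?_, ?_, ?_⟩ <;> rw [div_pow] <;> ring

/-- **Slot caps on an `H` half-slot** in the bookkeeping form of `lipEnvelope_two_of_caps`
(`c₃ = 8π²`, `c₄ = 80π³/√(2π)`, `c₅ = 192π⁴`, `s = N_j/δ_j`, rate `= rateH j t ≥ 0`). [folklore] -/
theorem caps_H (P : CascadeParams) (hγ : 0 ≤ P.γ) (hδ₀ : 0 < P.δ₀) (hd : 0 < P.d) (ν : ℝ) (j : ℕ) :
    ∀ t ∈ Icc (CascadeParams.tStart j) (CascadeParams.tStart j + CascadeParams.tHalf j),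
      (∀ x (i m : Fin 2), |Torus.partialDeriv i (Torus.partialDeriv m
          (torusVorticityTensor (P.field t) 0 1)) x| ≤
        P.rateH j t * (8 * Real.pi ^ 2 * (((P.N j : ℕ) : ℝ) / P.δ j) ^ 2)) ∧
      (∀ x (i l m : Fin 2), |Torus.partialDeriv i (Torus.partialDeriv l (Torus.partialDeriv m
          (torusVorticityTensor (P.field t) 0 1))) x| ≤
        P.rateH j t * (80 * Real.pi ^ 3 / Real.sqrt (2 * Real.pi) * (((P.N j : ℕ) : ℝ) / P.δ j) ^ 3)) ∧
      Real.sqrt (∫ x, (Torus.partialDeriv 0 (fun y => ν • Torus.laplacian (P.field t) y) x 1 -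
          Torus.partialDeriv 1 (fun y => ν • Torus.laplacian (P.field t) y) x 0) ^ 2) ≤
        P.rateH j t * (|ν| * (8 * Real.pi ^ 2) * (((P.N j : ℕ) : ℝ) / P.δ j) ^ 2) ∧
      Real.sqrt (scalarGradNormSq (fun x =>
          Torus.partialDeriv 0 (fun y => ν • Torus.laplacian (P.field t) y) x 1 -
          Torus.partialDeriv 1 (fun y => ν • Torus.laplacian (P.field t) y) x 0)) ≤
        P.rateH j t * (|ν| * (80 * Real.pi ^ 3 / Real.sqrt (2 * Real.pi)) * (((P.N j : ℕ) : ℝ) / P.δ j) ^ 3) ∧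
      Real.sqrt (∑ i, ∑ m, ∫ x, (Torus.partialDeriv i (Torus.partialDeriv m (fun x =>
          Torus.partialDeriv 0 (fun y => ν • Torus.laplacian (P.field t) y) x 1 -
          Torus.partialDeriv 1 (fun y => ν • Torus.laplacian (P.field t) y) x 0)) x) ^ 2) ≤
        P.rateH j t * (|ν| * (192 * Real.pi ^ 4) * (((P.N j : ℕ) : ℝ) / P.δ j) ^ 4) := by
  intro t ht
  have hδ : 0 < P.δ j := P.δ_pos hδ₀ hd j
  have hr : 0 ≤ P.rateH j t := P.rateH_nonneg hγ j t
  have habs : |P.rateH j t| = P.rateH j t := abs_of_nonneg hr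
  have hνr : |ν * P.rateH j t| = |ν| * P.rateH j t := by rw [abs_mul, habs]
  obtain ⟨e₂, e₃, e₄⟩ := cap_consts P j
  refine ⟨fun x i m => ?_, fun x i l m => ?_, ?_, ?_, ?_⟩
  · have h := P.abs_partialDeriv2_vorticity_field_le_of_mem_H hδ ht x i m
    rw [habs, e₂] at h
    exact h
  · have h := P.abs_partialDeriv3_vorticity_field_le_of_mem_H hδ ht x i l m
    rw [habs, e₃] at h
    exact h
  · have hcont := (P.isSmooth_vorticity_viscousForce_of_mem_H hδ ht ν).continuous
    have hpt : ∀ x, |torusVorticityTensor (fun x => ν • Torus.laplacian (P.field t) x) 0 1 x| ≤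
        P.rateH j t * (|ν| * (8 * Real.pi ^ 2) * (((P.N j : ℕ) : ℝ) / P.δ j) ^ 2) := by
      intro x
      rw [P.vorticity_viscousForce_eq_coordFun_of_mem_H hδ ht ν]
      dsimp only
      rw [abs_mul, abs_neg, hνr]
      have h3 := P.abs_deriv3_U_le hδ (Torus.repr x 1)
      rw [e₂] at h3
      calc |ν| * P.rateH j t * |deriv (deriv (deriv (P.U j))) (Torus.repr x 1)|
          ≤ |ν| * P.rateH j t * (8 * Real.pi ^ 2 * (((P.N j : ℕ) : ℝ) / P.δ j) ^ 2) :=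
            mul_le_mul_of_nonneg_left h3 (mul_nonneg (abs_nonneg ν) hr)
        _ = P.rateH j t * (|ν| * (8 * Real.pi ^ 2) * (((P.N j : ℕ) : ℝ) / P.δ j) ^ 2) := by ring
    exact sqrt_integral_sq_le_of_abs_le_fin_two hcont (by positivity) hpt
  · have h := (P.vorticity_viscousForce_sizes_of_mem_H hδ ht ν).1
    rw [hνr, e₃] at h
    have e : |ν| * P.rateH j t * (80 * Real.pi ^ 3 / Real.sqrt (2 * Real.pi) * (((P.N j : ℕ) : ℝ) / P.δ j) ^ 3) =
        P.rateH j t * (|ν| * (80 * Real.pi ^ 3 / Real.sqrt (2 * Real.pi)) * (((P.N j : ℕ) : ℝ) / P.δ j) ^ 3) := by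
      ring
    rw [e] at h
    exact h
  · have h := (P.vorticity_viscousForce_sizes_of_mem_H hδ ht ν).2
    rw [hνr, e₄] at h
    have e : |ν| * P.rateH j t * (192 * Real.pi ^ 4 * (((P.N j : ℕ) : ℝ) / P.δ j) ^ 4) =
        P.rateH j t * (|ν| * (192 * Real.pi ^ 4) * (((P.N j : ℕ) : ℝ) / P.δ j) ^ 4) := by ring
    rw [e] at h
    exact h

/-- **Slot caps on a `V` half-slot** in the bookkeeping form of `lipEnvelope_two_of_caps`
(`c₃ = 8π²`, `c₄ = 80π³/√(2π)`, `c₅ = 192π⁴`, `s = N_j/δ_j`, rate `= rateV j t ≥ 0`). [folklore] -/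
theorem caps_V (P : CascadeParams) (hγ : 0 ≤ P.γ) (hδ₀ : 0 < P.δ₀) (hd : 0 < P.d) (ν : ℝ) (j : ℕ) :
    ∀ t ∈ Icc (CascadeParams.tStart j + CascadeParams.tHalf j) (CascadeParams.tStart (j + 1)),
      (∀ x (i m : Fin 2), |Torus.partialDeriv i (Torus.partialDeriv m
          (torusVorticityTensor (P.field t) 0 1)) x| ≤
        P.rateV j t * (8 * Real.pi ^ 2 * (((P.N j : ℕ) : ℝ) / P.δ j) ^ 2)) ∧
      (∀ x (i l m : Fin 2), |Torus.partialDeriv i (Torus.partialDeriv l (Torus.partialDeriv m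
          (torusVorticityTensor (P.field t) 0 1))) x| ≤
        P.rateV j t * (80 * Real.pi ^ 3 / Real.sqrt (2 * Real.pi) * (((P.N j : ℕ) : ℝ) / P.δ j) ^ 3)) ∧
      Real.sqrt (∫ x, (Torus.partialDeriv 0 (fun y => ν • Torus.laplacian (P.field t) y) x 1 -
          Torus.partialDeriv 1 (fun y => ν • Torus.laplacian (P.field t) y) x 0) ^ 2) ≤
        P.rateV j t * (|ν| * (8 * Real.pi ^ 2) * (((P.N j : ℕ) : ℝ) / P.δ j) ^ 2) ∧
      Real.sqrt (scalarGradNormSq (fun x =>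
          Torus.partialDeriv 0 (fun y => ν • Torus.laplacian (P.field t) y) x 1 -
          Torus.partialDeriv 1 (fun y => ν • Torus.laplacian (P.field t) y) x 0)) ≤
        P.rateV j t * (|ν| * (80 * Real.pi ^ 3 / Real.sqrt (2 * Real.pi)) * (((P.N j : ℕ) : ℝ) / P.δ j) ^ 3) ∧
      Real.sqrt (∑ i, ∑ m, ∫ x, (Torus.partialDeriv i (Torus.partialDeriv m (fun x =>
          Torus.partialDeriv 0 (fun y => ν • Torus.laplacian (P.field t) y) x 1 -
          Torus.partialDeriv 1 (fun y => ν • Torus.laplacian (P.field t) y) x 0)) x) ^ 2) ≤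
        P.rateV j t * (|ν| * (192 * Real.pi ^ 4) * (((P.N j : ℕ) : ℝ) / P.δ j) ^ 4) := by
  intro t ht
  have hδ : 0 < P.δ j := P.δ_pos hδ₀ hd j
  have hr : 0 ≤ P.rateV j t := P.rateV_nonneg hγ j t
  have habs : |P.rateV j t| = P.rateV j t := abs_of_nonneg hr
  have hνr : |ν * P.rateV j t| = |ν| * P.rateV j t := by rw [abs_mul, habs]
  obtain ⟨e₂, e₃, e₄⟩ := cap_consts P j
  refine ⟨fun x i m => ?_, fun x i l m => ?_, ?_, ?_, ?_⟩
  · have h := P.abs_partialDeriv2_vorticity_field_le_of_mem_V hδ ht x i m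
    rw [habs, e₂] at h
    exact h
  · have h := P.abs_partialDeriv3_vorticity_field_le_of_mem_V hδ ht x i l m
    rw [habs, e₃] at h
    exact h
  · have hcont := (P.isSmooth_vorticity_viscousForce_of_mem_V hδ ht ν).continuous
    have hpt : ∀ x, |torusVorticityTensor (fun x => ν • Torus.laplacian (P.field t) x) 0 1 x| ≤
        P.rateV j t * (|ν| * (8 * Real.pi ^ 2) * (((P.N j : ℕ) : ℝ) / P.δ j) ^ 2) := by
      intro x
      rw [P.vorticity_viscousForce_eq_coordFun_of_mem_V hδ ht ν]
      dsimp only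
      rw [abs_mul, hνr]
      have h3 := P.abs_deriv3_U_le hδ (Torus.repr x 0)
      rw [e₂] at h3
      calc |ν| * P.rateV j t * |deriv (deriv (deriv (P.U j))) (Torus.repr x 0)|
          ≤ |ν| * P.rateV j t * (8 * Real.pi ^ 2 * (((P.N j : ℕ) : ℝ) / P.δ j) ^ 2) :=
            mul_le_mul_of_nonneg_left h3 (mul_nonneg (abs_nonneg ν) hr)
        _ = P.rateV j t * (|ν| * (8 * Real.pi ^ 2) * (((P.N j : ℕ) : ℝ) / P.δ j) ^ 2) := by ring
    exact sqrt_integral_sq_le_of_abs_le_fin_two hcont (by positivity) hpt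
  · have h := (P.vorticity_viscousForce_sizes_of_mem_V hδ ht ν).1
    rw [hνr, e₃] at h
    have e : |ν| * P.rateV j t * (80 * Real.pi ^ 3 / Real.sqrt (2 * Real.pi) * (((P.N j : ℕ) : ℝ) / P.δ j) ^ 3) =
        P.rateV j t * (|ν| * (80 * Real.pi ^ 3 / Real.sqrt (2 * Real.pi)) * (((P.N j : ℕ) : ℝ) / P.δ j) ^ 3) := by
      ring
    rw [e] at h
    exact h
  · have h := (P.vorticity_viscousForce_sizes_of_mem_V hδ ht ν).2
    rw [hνr, e₄] at h
    have e : |ν| * P.rateV j t * (192 * Real.pi ^ 4 * (((P.N j : ℕ) : ℝ) / P.δ j) ^ 4) =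
        P.rateV j t * (|ν| * (192 * Real.pi ^ 4) * (((P.N j : ℕ) : ℝ) / P.δ j) ^ 4) := by ring
    rw [e] at h
    exact h

end Summit.AnomalousDissipation.AnomalousDissipation.Theorems.SawtoothPulseCascade.LipAgmon

end
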